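import Mathlib
import Literature.MathematicalPhysics.QuantumFieldTheory.Balaban1983to89.B6RandomWalk

/-!
# `Balaban1983to89.B9Thm314ResolventTwoMetricWeighted` — [Balaban1985BackgroundPropagators] Theorem 3.14 (pp. 426–427, (3.154)) by the resolvent route: the
# TWO-DISTANCE engine of `B9Thm314ResolventTwoMetric` WITH the scale weights of `B9Thm314ResolventWeighted` — the single statement a pin instantiates for the
# additional factor of a Thm-3.14 member (left operator in its multiscale distance `d₁` with output weight `w₁`, right operator with ANY profile `e₂` dominating the
# lattice distance `t` and weights `w₂(y₂)r(y′)`, middle factor local in `d₁` with weight `u(y₁)` and rows on `S`, the middle weights moved to the output block by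
# one (2.60)-shape transfer hypothesis); output `C₁vC₂Λc²·w₁(y)W(y)r(y′)·e^{−(δ/4)F(y,y′)}`, constants of the inputs only

B9 = T. Bałaban, *Propagators for lattice gauge theories in a background field*, Commun. Math. Phys. **99** (1985) 389–434 [Balaban1985BackgroundPropagators]; [4] =
[Balaban1984PropagatorsII] (2.51)–(2.55) p. 232, (2.60)–(2.61) p. 234.  DAG node N06, seat `pub-ymgap-dag-n06-a`; design note `B9-PIN-DESIGN-g2.md` §8.  The characteristic
factor is re-attached by `B9Thm314ResolventTwoMetric.hasMajorant_geomMean` from the plain two-term bound; this file only produces the additional factor.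

WHAT IS PROVED (kernel; no `sorry`; every analytic input displayed): `hasMajorant_resolvent_twoMetric_weighted` (see the signature).  HONEST SCOPE: one block structure for the
composition (right operator re-blocked, `B6MajorantReblock`); sup-type block majorants; count-neutral; NOT continuum ∕ Clay.
-/

namespace Literature.MathematicalPhysics.QuantumFieldTheory.Balaban1983to89.B9Thm314ResolventTwoMetricWeighted

open Finset
open Literature.MathematicalPhysics.QuantumFieldTheory.Balaban1983to89.B6RandomWalk (HasMajorant hasMajorant_mono hasMajorant_mul)

variable {g : B6.Geometry} {X : Type}

/-- [4] (2.55) twice. [cite: Balaban1984PropagatorsII, (2.52)–(2.55) p.232] -/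
private theorem hasMajorant_mul₃ (blk : X → g.Site) {T₁ V T₂ : Module.End ℝ (X → ℝ)} {K₁ KV K₂ : g.Site → g.Site → ℝ}
    (h₁ : HasMajorant blk T₁ K₁) (hV : HasMajorant blk V KV) (h₂ : HasMajorant blk T₂ K₂) (hKV : ∀ a b, 0 ≤ KV a b)
    (hK₂ : ∀ a b, 0 ≤ K₂ a b) :
    HasMajorant blk (T₁ * V * T₂) (fun a b => ∑ y₁ : g.Site, ∑ y₂ : g.Site, K₁ a y₁ * KV y₁ y₂ * K₂ y₂ b) := by
  refine hasMajorant_mono blk (hasMajorant_mul blk (hasMajorant_mul blk h₁ hV hKV) h₂ hK₂) fun a b => le_of_eq ?_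
  simp only [Finset.sum_mul]
  rw [Finset.sum_comm]

/-- (2.61) at a weaker rate dominates the sum at a stronger one (for `d ≥ 0`). [cite: Balaban1984PropagatorsII, Lemma 2.1 (2.61) p.234 (bookkeeping)] -/
private theorem sum_exp_le_of_rate {σ δ c : ℝ} (hσδ : σ ≤ δ) (hd : ∀ a b : g.Site, 0 ≤ g.dist a b)
    (hsum : ∀ y : g.Site, ∑ y' : g.Site, Real.exp (-(σ * g.dist y y')) ≤ c) (y : g.Site) :
    ∑ y' : g.Site, Real.exp (-(δ * g.dist y y')) ≤ c := by
  refine le_trans (Finset.sum_le_sum fun y' _ => ?_) (hsum y)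
  exact Real.exp_le_exp.2 (neg_le_neg (mul_le_mul_of_nonneg_right hσδ (hd y y')))

/-- **THE TWO-DISTANCE RESOLVENT ENGINE WITH SCALE WEIGHTS** (see the module docstring for the reading of each hypothesis).
[cite: Balaban1985BackgroundPropagators, Thm 3.14 (3.154) pp.426–427 (bookkeeping: the resolvent route, two sequences, prefactors); Balaban1984PropagatorsII, (2.54)–(2.55) pp.232–233 and (2.60)–(2.61) p.234] -/
theorem hasMajorant_resolvent_twoMetric_weighted (blk : X → g.Site) (hd : ∀ a b : g.Site, 0 ≤ g.dist a b)
    (t : g.Site → g.Site → ℝ) (ht0 : ∀ a b, 0 ≤ t a b) (httri : ∀ a b c, t a c ≤ t a b + t b c) (htd : ∀ a b, t a b ≤ g.dist a b)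
    (e₂ : g.Site → g.Site → ℝ) (hte₂ : ∀ a b, t a b ≤ e₂ a b)
    {δ c C₁ C₂ v Λ : ℝ} (hδ : 0 ≤ δ) (hc : 0 ≤ c) (hC₁ : 0 ≤ C₁) (hC₂ : 0 ≤ C₂) (hv : 0 ≤ v) (hΛ : 0 ≤ Λ)
    (hsum : ∀ y : g.Site, ∑ y' : g.Site, Real.exp (-(δ / 4 * g.dist y y')) ≤ c)
    (S : Set g.Site) (F : g.Site → g.Site → ℝ) (hF : ∀ a b y₁ : g.Site, y₁ ∈ S → F a b ≤ t a y₁ + t y₁ b)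
    (w₁ u w₂ r W : g.Site → ℝ) (hw₁ : ∀ y, 0 ≤ w₁ y) (hu : ∀ y, 0 ≤ u y) (hr : ∀ y, 0 ≤ r y) (hW : ∀ y, 0 ≤ W y)
    (htr : ∀ a y₁ y₂ : g.Site,
      u y₁ * w₂ y₂ * Real.exp (-(δ / 2 * g.dist a y₁)) * Real.exp (-(δ / 2 * g.dist y₁ y₂)) ≤ Λ * W a)
    {T₁ V T₂ : Module.End ℝ (X → ℝ)} {K₁ KV K₂ : g.Site → g.Site → ℝ}
    (h₁ : HasMajorant blk T₁ K₁) (hV : HasMajorant blk V KV) (h₂ : HasMajorant blk T₂ K₂)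
    (hKV0 : ∀ a b, 0 ≤ KV a b) (hK₂0 : ∀ a b, 0 ≤ K₂ a b)
    (hK₁ : ∀ a y : g.Site, K₁ a y ≤ C₁ * w₁ a * Real.exp (-(δ * g.dist a y)))
    (hKV : ∀ y₁ y₂ : g.Site, KV y₁ y₂ ≤ v * u y₁ * Real.exp (-(2 * δ * g.dist y₁ y₂)))
    (hKVS : ∀ y₁ y₂ : g.Site, y₁ ∉ S → KV y₁ y₂ = 0)
    (hK₂ : ∀ y b : g.Site, K₂ y b ≤ C₂ * w₂ y * r b * Real.exp (-(δ * e₂ y b))) :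
    HasMajorant blk (T₁ * V * T₂)
      (fun a b => C₁ * v * C₂ * Λ * c * c * w₁ a * W a * r b * Real.exp (-(δ / 4 * F a b))) := by
  refine hasMajorant_mono blk (hasMajorant_mul₃ blk h₁ hV h₂ hKV0 hK₂0) fun a b => ?_
  set E : ℝ := Real.exp (-(δ / 4 * F a b)) with hE
  have hE0 : 0 ≤ E := Real.exp_nonneg _
  have hP : 0 ≤ C₁ * v * C₂ * Λ * c * w₁ a * W a * r b :=
    mul_nonneg (mul_nonneg (mul_nonneg (mul_nonneg (mul_nonneg (mul_nonneg (mul_nonneg hC₁ hv) hC₂) hΛ) hc) (hw₁ a))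
      (hW a)) (hr b)
  -- inner sum: Σ_{y₂} e^{−(3δ/2)d₁(y₁,y₂)} e^{−δe₂(y₂,b)} ≤ c·e^{−δt(y₁,b)}
  have inner : ∀ y₁ : g.Site, ∑ y₂ : g.Site, Real.exp (-(3 * δ / 2 * g.dist y₁ y₂)) * Real.exp (-(δ * e₂ y₂ b)) ≤
      c * Real.exp (-(δ * t y₁ b)) := by
    intro y₁
    have hterm : ∀ y₂ : g.Site, Real.exp (-(3 * δ / 2 * g.dist y₁ y₂)) * Real.exp (-(δ * e₂ y₂ b)) ≤
        Real.exp (-(δ / 2 * g.dist y₁ y₂)) * Real.exp (-(δ * t y₁ b)) := by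
      intro y₂
      rw [← Real.exp_add, ← Real.exp_add]
      apply Real.exp_le_exp.2
      have h1 := httri y₁ y₂ b
      have h2 := htd y₁ y₂
      have h3 := hte₂ y₂ b
      have h4 : δ * t y₁ b ≤ δ * (g.dist y₁ y₂ + e₂ y₂ b) := mul_le_mul_of_nonneg_left (by linarith) hδ
      linarith
    calc ∑ y₂ : g.Site, Real.exp (-(3 * δ / 2 * g.dist y₁ y₂)) * Real.exp (-(δ * e₂ y₂ b))
        ≤ ∑ y₂ : g.Site, Real.exp (-(δ / 2 * g.dist y₁ y₂)) * Real.exp (-(δ * t y₁ b)) := Finset.sum_le_sum fun y₂ _ => hterm y₂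
      _ = (∑ y₂ : g.Site, Real.exp (-(δ / 2 * g.dist y₁ y₂))) * Real.exp (-(δ * t y₁ b)) := by rw [Finset.sum_mul]
      _ ≤ c * Real.exp (-(δ * t y₁ b)) :=
          mul_le_mul_of_nonneg_right (sum_exp_le_of_rate (by linarith) hd hsum y₁) (Real.exp_nonneg _)
  have step : ∀ y₁ : g.Site, ∑ y₂ : g.Site, K₁ a y₁ * KV y₁ y₂ * K₂ y₂ b ≤
      C₁ * v * C₂ * Λ * c * w₁ a * W a * r b * E * Real.exp (-(δ / 4 * g.dist a y₁)) := by
    intro y₁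
    by_cases hy : y₁ ∈ S
    · have t1 : ∀ y₂ : g.Site, K₁ a y₁ * KV y₁ y₂ * K₂ y₂ b ≤
          C₁ * w₁ a * Real.exp (-(δ * g.dist a y₁)) * (v * u y₁ * Real.exp (-(2 * δ * g.dist y₁ y₂))) *
            (C₂ * w₂ y₂ * r b * Real.exp (-(δ * e₂ y₂ b))) := fun y₂ =>
        mul_le_mul (mul_le_mul (hK₁ a y₁) (hKV y₁ y₂) (hKV0 _ _)
          (mul_nonneg (mul_nonneg hC₁ (hw₁ a)) (Real.exp_nonneg _))) (hK₂ y₂ b) (hK₂0 _ _)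
          (mul_nonneg (mul_nonneg (mul_nonneg hC₁ (hw₁ a)) (Real.exp_nonneg _))
            (mul_nonneg (mul_nonneg hv (hu y₁)) (Real.exp_nonneg _)))
      have t2 : ∀ y₂ : g.Site,
          C₁ * w₁ a * Real.exp (-(δ * g.dist a y₁)) * (v * u y₁ * Real.exp (-(2 * δ * g.dist y₁ y₂))) *
            (C₂ * w₂ y₂ * r b * Real.exp (-(δ * e₂ y₂ b))) ≤
          C₁ * v * C₂ * Λ * w₁ a * W a * r b *
            (Real.exp (-(δ / 2 * g.dist a y₁)) * (Real.exp (-(3 * δ / 2 * g.dist y₁ y₂)) * Real.exp (-(δ * e₂ y₂ b)))) := by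
        intro y₂
        have s1 : Real.exp (-(δ * g.dist a y₁)) = Real.exp (-(δ / 2 * g.dist a y₁)) * Real.exp (-(δ / 2 * g.dist a y₁)) := by
          rw [← Real.exp_add]; ring_nf
        have s2 : Real.exp (-(2 * δ * g.dist y₁ y₂)) =
            Real.exp (-(δ / 2 * g.dist y₁ y₂)) * Real.exp (-(3 * δ / 2 * g.dist y₁ y₂)) := by
          rw [← Real.exp_add]; ring_nf
        rw [s1, s2]
        have hrest : 0 ≤ C₁ * v * C₂ * w₁ a * r b *
            (Real.exp (-(δ / 2 * g.dist a y₁)) * (Real.exp (-(3 * δ / 2 * g.dist y₁ y₂)) * Real.exp (-(δ * e₂ y₂ b)))) :=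
          mul_nonneg (mul_nonneg (mul_nonneg (mul_nonneg (mul_nonneg hC₁ hv) hC₂) (hw₁ a)) (hr b))
            (mul_nonneg (Real.exp_nonneg _) (mul_nonneg (Real.exp_nonneg _) (Real.exp_nonneg _)))
        have key := mul_le_mul_of_nonneg_left (htr a y₁ y₂) hrest
        calc C₁ * w₁ a * (Real.exp (-(δ / 2 * g.dist a y₁)) * Real.exp (-(δ / 2 * g.dist a y₁))) *
              (v * u y₁ * (Real.exp (-(δ / 2 * g.dist y₁ y₂)) * Real.exp (-(3 * δ / 2 * g.dist y₁ y₂)))) *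
              (C₂ * w₂ y₂ * r b * Real.exp (-(δ * e₂ y₂ b)))
            = C₁ * v * C₂ * w₁ a * r b *
                (Real.exp (-(δ / 2 * g.dist a y₁)) * (Real.exp (-(3 * δ / 2 * g.dist y₁ y₂)) * Real.exp (-(δ * e₂ y₂ b)))) *
                (u y₁ * w₂ y₂ * Real.exp (-(δ / 2 * g.dist a y₁)) * Real.exp (-(δ / 2 * g.dist y₁ y₂))) := by ring
          _ ≤ C₁ * v * C₂ * w₁ a * r b *
                (Real.exp (-(δ / 2 * g.dist a y₁)) * (Real.exp (-(3 * δ / 2 * g.dist y₁ y₂)) * Real.exp (-(δ * e₂ y₂ b)))) *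
                (Λ * W a) := key
          _ = C₁ * v * C₂ * Λ * w₁ a * W a * r b *
                (Real.exp (-(δ / 2 * g.dist a y₁)) * (Real.exp (-(3 * δ / 2 * g.dist y₁ y₂)) * Real.exp (-(δ * e₂ y₂ b)))) := by
              ring
      have hQ : 0 ≤ C₁ * v * C₂ * Λ * w₁ a * W a * r b * Real.exp (-(δ / 2 * g.dist a y₁)) :=
        mul_nonneg (mul_nonneg (mul_nonneg (mul_nonneg (mul_nonneg (mul_nonneg (mul_nonneg hC₁ hv) hC₂) hΛ) (hw₁ a)) (hW a))
          (hr b)) (Real.exp_nonneg _)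
      have hsum₁ : ∑ y₂ : g.Site, K₁ a y₁ * KV y₁ y₂ * K₂ y₂ b ≤
          C₁ * v * C₂ * Λ * w₁ a * W a * r b * Real.exp (-(δ / 2 * g.dist a y₁)) *
            ∑ y₂ : g.Site, Real.exp (-(3 * δ / 2 * g.dist y₁ y₂)) * Real.exp (-(δ * e₂ y₂ b)) := by
        rw [Finset.mul_sum]
        refine Finset.sum_le_sum fun y₂ _ => ((t1 y₂).trans (t2 y₂)).trans (le_of_eq ?_)
        ring
      -- exponent bookkeeping: (δ/2)d₁(a,y₁) + δt(y₁,b) ≥ (δ/4)(F(a,b) + d₁(a,y₁))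
      have hexp : Real.exp (-(δ / 2 * g.dist a y₁)) * Real.exp (-(δ * t y₁ b)) ≤ E * Real.exp (-(δ / 4 * g.dist a y₁)) := by
        rw [hE, ← Real.exp_add, ← Real.exp_add]
        apply Real.exp_le_exp.2
        have hFab := hF a b y₁ hy
        have h1 := htd a y₁
        have h2 := ht0 y₁ b
        have h3 := hd a y₁
        have h4 : δ / 4 * (F a b + g.dist a y₁) ≤ δ / 4 * (2 * g.dist a y₁ + t y₁ b) :=
          mul_le_mul_of_nonneg_left (by linarith) (by linarith)
        have h5 : 0 ≤ δ * t y₁ b := mul_nonneg hδ h2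
        linarith
      calc ∑ y₂ : g.Site, K₁ a y₁ * KV y₁ y₂ * K₂ y₂ b
          ≤ C₁ * v * C₂ * Λ * w₁ a * W a * r b * Real.exp (-(δ / 2 * g.dist a y₁)) * (c * Real.exp (-(δ * t y₁ b))) :=
            hsum₁.trans (mul_le_mul_of_nonneg_left (inner y₁) hQ)
        _ = C₁ * v * C₂ * Λ * c * w₁ a * W a * r b * (Real.exp (-(δ / 2 * g.dist a y₁)) * Real.exp (-(δ * t y₁ b))) := by
            ring
        _ ≤ C₁ * v * C₂ * Λ * c * w₁ a * W a * r b * (E * Real.exp (-(δ / 4 * g.dist a y₁))) :=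
            mul_le_mul_of_nonneg_left hexp hP
        _ = C₁ * v * C₂ * Λ * c * w₁ a * W a * r b * E * Real.exp (-(δ / 4 * g.dist a y₁)) := by ring
    · have h0 : ∀ y₂ : g.Site, K₁ a y₁ * KV y₁ y₂ * K₂ y₂ b = 0 := fun y₂ => by rw [hKVS y₁ y₂ hy, mul_zero, zero_mul]
      simp only [h0, Finset.sum_const_zero]
      exact mul_nonneg (mul_nonneg hP hE0) (Real.exp_nonneg _)
  calc ∑ y₁ : g.Site, ∑ y₂ : g.Site, K₁ a y₁ * KV y₁ y₂ * K₂ y₂ b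
      ≤ ∑ y₁ : g.Site, C₁ * v * C₂ * Λ * c * w₁ a * W a * r b * E * Real.exp (-(δ / 4 * g.dist a y₁)) :=
        Finset.sum_le_sum fun y₁ _ => step y₁
    _ = C₁ * v * C₂ * Λ * c * w₁ a * W a * r b * E * ∑ y₁ : g.Site, Real.exp (-(δ / 4 * g.dist a y₁)) := by
        rw [Finset.mul_sum]
    _ ≤ C₁ * v * C₂ * Λ * c * w₁ a * W a * r b * E * c := mul_le_mul_of_nonneg_left (hsum a) (mul_nonneg hP hE0)
    _ = C₁ * v * C₂ * Λ * c * c * w₁ a * W a * r b * Real.exp (-(δ / 4 * F a b)) := by rw [hE]; ring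

end Literature.MathematicalPhysics.QuantumFieldTheory.Balaban1983to89.B9Thm314ResolventTwoMetricWeighted
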